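import Summits.ResolutionOfSingularities.ResolutionOfSingularities.Theorems.FrobeniusClosingPatchingRelPerfectDepthMultiHostFormatSnc
import Summits.ResolutionOfSingularities.ResolutionOfSingularities.Theorems.FrobeniusClosingPatchingRelPerfectDepthHSepComponentsExp
import Literature.AlgebraicGeometry.Resolution.HasSNCStrictNormalCrossings
import HarnessLib

/-!
# Crux `PatchingRelPerfect` (stmt-ResolutionOfSingularities-16161), chain W5.2 — F7(β) d = 2 (β-AX) A1 «END CURRENCY»:
# the HOST-FACTORISATION clause of `IsFormatSncOn` is derivable (res-L1-w52-plan-1 Q13-c / G11-15 (1)(d) / G11-17 (2)(i))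

[OURS · L1 W5.2 · F7(β) (β-AX) A1 · hand res-D-pv-021 g9; §2 REBASED VERBATIM IN CONTENT from res-D-pv-054 g7's farm-clean draft
`D/res-D-pv-054/FormatSnc.draft.lean` (sha16 1f022f105af0b041, 2026-08-27T16:12:46Z HANDOVER) onto the typed form of record
`MultiHostState.IsFormatSncOn S U 𝓒 𝓗` (p546954, exponent LISTS on the common family `𝓒 ++ S.𝓔`).]  Replaces the role of NO printed
item; NOT a statement of the manuscript under review (Hironaka 2017); fact-free; AI-written, AI review weaker than expert review.
No definitions.

* `MultiHostState.isFormatSncOn_ofFun_components` — the exponent-FUNCTION constructor with exponents on the COMPONENTS `𝓒` only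
  (zeros on the members `S.𝓔`; safe when a component literally coincides with a member): host lists
  `𝓒.map (H ↦ (H, c i H)) ++ S.𝓔.map (T ↦ (T, 0))`.
* `exists_expFun_of_isEffectiveCartier` (res-D-pv-054) — on a regular integral Noetherian scheme, an effective Cartier divisor whose
  support is covered by an snc `Nodup` family of prime divisors (irreducible non-unit supports) IS a monomial in that family with
  exponents a FUNCTION on the family (the divisorial part, Cossart–Piltant 2008 Prop. 4.2, via res-D-pv-054's
  `HSepCJS.exists_factors_of_support_subset` + `exists_expFun_of_factors`).
* **`MultiHostState.exists_isFormatSncOn_of_support_subset`** — hence the host-factorisation clause of the format-snc END is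
  DERIVABLE: on an open `U` (integral, Noetherian, regular) where the family `𝓒 ++ S.𝓔` is snc, `𝓒|_U` is `Nodup` with irreducible
  non-unit supports, and every host is effective Cartier with support in `⋃ Supp 𝓒|_U`, SOME host lists `𝓗` give
  `S.IsFormatSncOn U 𝓒 𝓗` — so T2c / X3 only have to produce the snc family and the component list.

## References
* V. Cossart, O. Piltant, *Resolution of singularities of threefolds in positive characteristic I*, J. Algebra 320 (2008), proof
  of Prop. 4.2 (divisorial part of a hypersurface in an snc divisor). [CossartPiltant2008]
* J. Kollár, *Lectures on Resolution of Singularities* (2007), (3.111) Step 3. [Kollar2007]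
* E. Bierstone, D. Grigoriev, P. Milman, J. Włodarczyk (2011), Def. 3.1.1, Def. 3.1.3. [BierstoneGrigorievMilmanWlodarczyk2011]
* The Stacks Project, Tag 0BIA. [StacksProject]
-/

-- `Summit.<Summit>.<Sub>.Theorems` with `Sub = Summit` (single-conjunct summit, D-0017)
set_option linter.dupNamespace false

noncomputable section

open CategoryTheory AlgebraicGeometry TopologicalSpace
open Literature.AlgebraicGeometry.Resolution Scheme.IdealSheafData

namespace Summit.ResolutionOfSingularities.ResolutionOfSingularities.Theorems.DepthMultiHost

universe u

variable {X : Scheme.{u}}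

/-! ## §1 Exponent functions on the components only -/

namespace MultiHostState

/-- [OURS · L1 W5.2] **Exponent-FUNCTION constructor, components only**: if ON `U` the family `𝓒 ++ S.𝓔` has simple normal crossings and
every host factors over the COMPONENTS, `(host i)|_U = (Π_{H ∈ 𝓒} 𝓘_H^{c i H})|_U`, then `S` is format-snc END on `U` with host lists
`𝓒.map (H ↦ (H, c i H)) ++ S.𝓔.map (T ↦ (T, 0))` (zeros on the members, so a component that literally coincides with a member is
not counted twice — contrast `isFormatSncOn_ofFun`). [cite: Kollar2007, (3.111) Step 3] [cite: BierstoneGrigorievMilmanWlodarczyk2011, Def. 3.1.3] -/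
theorem isFormatSncOn_ofFun_components (S : MultiHostState X) (U : X.Opens) (𝓒 : List X.IdealSheafData)
    (c : Fin S.n → X.IdealSheafData → ℕ) (hsnc : HasSNC ((𝓒 ++ S.𝓔).map fun F => F.comap U.ι))
    (hhost : ∀ i, (S.host i).comap U.ι = (monomialIdeal (𝓒.map fun H => (H, c i H))).comap U.ι) :
    S.IsFormatSncOn U 𝓒 fun i => (𝓒.map fun H => (H, c i H)) ++ S.𝓔.map fun T => (T, 0) := by
  have h0 : ∀ L : List X.IdealSheafData, monomialIdeal (L.map fun T => (T, 0)) = ⊤ := by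
    intro L
    induction L with
    | nil => rw [List.map_nil, monomialIdeal_nil]
    | cons T L ih => rw [List.map_cons, monomialIdeal_cons, ih, pow_zero, Scheme.IdealSheafData.one_eq_top,
        Scheme.IdealSheafData.top_mul]
  refine ⟨fun i => ?_, hsnc, fun i => ?_⟩
  · simp [boundaryOf, List.map_append, List.map_map, Function.comp_def]
  · rw [hhost i, monomialIdeal_append, h0, Scheme.IdealSheafData.mul_top]

end MultiHostState

/-! ## §2 The host factorisation is derivable (res-D-pv-054's lemma, rebased) -/

/-- **An snc `Nodup` family of prime divisors presents every effective Cartier divisor it supports** (exponent-FUNCTION form;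
res-D-pv-054 g7, `D/res-D-pv-054/FormatSnc.draft.lean` §(d), verbatim in content): on a regular integral Noetherian scheme `W`, if
`𝓒` has simple normal crossings, no duplicates, and every non-unit member has irreducible support, then every effective Cartier `H`
with `Supp H ⊆ ⋃_{C ∈ 𝓒} Supp C` is `monomialIdeal (𝓒.map fun C => (C, e C))`.  The union is a strict normal crossings divisor
(`HasSNCWith.isStrictNormalCrossingsDivisor_biUnion_support`) whose maximal points are the generic points of the members' supports,
so `HSepCJS.exists_factors_of_support_subset` + `exists_expFun_of_factors` apply. [cite: CossartPiltant2008, proof of Prop. 4.2]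
[cite: StacksProject, Tag 0BIA] -/
theorem exists_expFun_of_isEffectiveCartier (W : Scheme.{u}) [IsIntegral W] [IsNoetherian W] (hW : Scheme.IsRegular W)
    {𝓒 : List W.IdealSheafData} (h𝓒 : HasSNC 𝓒) (hnd : 𝓒.Nodup) (hirr : ∀ C ∈ 𝓒, C ≠ ⊤ → IsIrreducible (C.support : Set W))
    (H : W.IdealSheafData) (hH : IsEffectiveCartier H) (hsupp : (H.support : Set W) ⊆ ⋃ C ∈ 𝓒, (C.support : Set W)) :
    ∃ e : W.IdealSheafData → ℕ, H = monomialIdeal (𝓒.map fun C => (C, e C)) := by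
  have hS : IsStrictNormalCrossingsDivisor W (⋃ C ∈ 𝓒, (C.support : Set W)) := h𝓒.isStrictNormalCrossingsDivisor_biUnion_support
  -- the maximal points of the union are generic points of members' supports
  have hmem : ∀ η ∈ maxPoints (⋃ C ∈ 𝓒, (C.support : Set W)), vanishingIdeal ⟨closure {η}, isClosed_closure⟩ ∈ 𝓒 := by
    intro η hη
    obtain ⟨hηS, hmax⟩ := mem_maxPoints_iff.mp hη
    obtain ⟨C, hC, hηC⟩ := Set.mem_iUnion₂.mp hηS
    have hCt : C ≠ ⊤ := by
      intro h
      rw [h, Scheme.IdealSheafData.support_top] at hηC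
      exact hηC
    obtain ⟨ξ, hξ⟩ : ∃ ξ : W, IsGenericPoint ξ (C.support : Set W) := QuasiSober.sober (hirr C hC hCt) C.support.isClosed
    have hξη : ξ ⤳ η := hξ.specializes hηC
    have hξS : ξ ∈ ⋃ C ∈ 𝓒, (C.support : Set W) := Set.mem_iUnion₂.mpr ⟨C, hC, hξ.mem⟩
    have heq : ξ = η := hmax ξ hξS hξη
    subst heq
    have hcl : (⟨closure {ξ}, isClosed_closure⟩ : Closeds W) = C.support := Closeds.ext hξ.def
    rw [hcl, h𝓒.vanishingIdeal_support hC]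
    exact hC
  obtain ⟨q, hq, hHq⟩ := HSepCJS.exists_factors_of_support_subset W hW hS hmem H hH hsupp
  obtain ⟨e, he⟩ := HSepCJS.exists_expFun_of_factors hnd q hq
  exact ⟨e, hHq.trans he⟩

namespace MultiHostState

/-- **Format-snc END from the snc clause and the support of the hosts** (res-L1-w52-plan-1 Q13-c; res-D-pv-054's U-form, rebased):
on an open `U` with `U` integral Noetherian regular, if the restricted family `𝓒 ++ S.𝓔` is snc, `𝓒|_U` is `Nodup` with irreducible
non-unit supports, and every host is effective Cartier on `U` with support inside `⋃ Supp 𝓒|_U`, then `S.IsFormatSncOn U 𝓒 𝓗` for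
SOME host lists `𝓗` (the exponent-function lists of `isFormatSncOn_ofFun_components`).  So T2c / X3 only have to produce the snc
family and the component list. [cite: CossartPiltant2008, proof of Prop. 4.2] [cite: BierstoneGrigorievMilmanWlodarczyk2011, Def. 3.1.3] -/
theorem exists_isFormatSncOn_of_support_subset (S : MultiHostState X) (U : X.Opens) (𝓒 : List X.IdealSheafData)
    [IsIntegral (U : Scheme.{u})] [IsNoetherian (U : Scheme.{u})] (hU : Scheme.IsRegular (U : Scheme.{u}))
    (hsnc : HasSNC ((𝓒 ++ S.𝓔).map fun F => F.comap U.ι)) (hnd : (𝓒.map fun F => F.comap U.ι).Nodup)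
    (hirr : ∀ C ∈ 𝓒, C.comap U.ι ≠ ⊤ → IsIrreducible (((C.comap U.ι).support : Closeds (U : Scheme.{u})) : Set (U : Scheme.{u})))
    (hhost : ∀ i, IsEffectiveCartier ((S.host i).comap U.ι))
    (hsupp : ∀ i, (((S.host i).comap U.ι).support : Set (U : Scheme.{u})) ⊆
      ⋃ C ∈ 𝓒, (((C.comap U.ι).support : Closeds (U : Scheme.{u})) : Set (U : Scheme.{u}))) :
    ∃ 𝓗 : Fin S.n → List (X.IdealSheafData × ℕ), S.IsFormatSncOn U 𝓒 𝓗 := by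
  classical
  have h𝓒 : HasSNC (𝓒.map fun F => F.comap U.ι) := DepthGraded.Trace.hasSNCWith_of_subset hsnc fun D hD => by
    rw [List.map_append]; exact List.mem_append_left _ hD
  have hirr' : ∀ C' ∈ 𝓒.map (fun F => F.comap U.ι), C' ≠ ⊤ →
      IsIrreducible ((C'.support : Closeds (U : Scheme.{u})) : Set (U : Scheme.{u})) := by
    intro C' hC' hC't
    obtain ⟨C, hC, rfl⟩ := List.mem_map.mp hC'
    exact hirr C hC hC't
  have hsupp' : ∀ i, (((S.host i).comap U.ι).support : Set (U : Scheme.{u})) ⊆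
      ⋃ C' ∈ 𝓒.map (fun F => F.comap U.ι), ((C'.support : Closeds (U : Scheme.{u})) : Set (U : Scheme.{u})) := by
    intro i y hy
    obtain ⟨C, hC, hyC⟩ := Set.mem_iUnion₂.mp (hsupp i hy)
    exact Set.mem_iUnion₂.mpr ⟨C.comap U.ι, List.mem_map.mpr ⟨C, hC, rfl⟩, hyC⟩
  -- factorise each host on `U` over the restricted family, then read the exponents back on `𝓒`
  have key : ∀ i, ∃ ci : X.IdealSheafData → ℕ,
      (S.host i).comap U.ι = (monomialIdeal (𝓒.map fun H => (H, ci H))).comap U.ι := by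
    intro i
    obtain ⟨e, he⟩ := exists_expFun_of_isEffectiveCartier (U : Scheme.{u}) hU h𝓒 hnd hirr' _ (hhost i) (hsupp' i)
    refine ⟨fun H => e (H.comap U.ι), ?_⟩
    rw [he, DepthTargets.comap_monomialIdeal_eq_map, List.map_map, List.map_map]
    rfl
  choose c hc using key
  exact ⟨_, S.isFormatSncOn_ofFun_components U 𝓒 c hsnc hc⟩

end MultiHostState

end Summit.ResolutionOfSingularities.ResolutionOfSingularities.Theorems.DepthMultiHost

end
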